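import Mathlib.LinearAlgebra.FreeModule.Basic
import Mathlib.LinearAlgebra.PiTensorProduct.Basis
import Mathlib.RingTheory.TensorProduct.Free
import Literature.AlgebraicGeometry.Motives.HodgeTensor
import HarnessLib

/-!
# Finiteness of the Hodge filtration on tensor powers (proofs for `HodgeTensor`)

Discharges of the named facts `Literature.AlgebraicGeometry.Motives.HodgeStructure.exists_tensorPowerFiltration_eq_bot`
(separation) and `Literature.AlgebraicGeometry.Motives.HodgeStructure.exists_tensorPowerFiltration_eq_top` (exhaustion) of
`Literature.AlgebraicGeometry.Motives.HodgeTensor`, i.e. finiteness of the filtration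
`F^p (V^{⊗r}) = Σ_{p ≤ Σ aᵢ} ⊗ᵢ F^{aᵢ} V` on the `r`-fold tensor power of a pure `ℚ`-Hodge structure
(Deligne, *Théorie de Hodge II*, 1.1.12: the filtration induced on the value of a multiadditive
functor, here `⊗^r`; reproduced in Cattani–El Zein–Griffiths–Lê, *Hodge Theory*, Ch. 3,
§3.2.1.6–3.2.1.7 "Multifunctor": `F^k H(A₁,…,Aₙ) = Σ_{Σ kᵢ = k} Im(H(F^{k₁}A₁,…,F^{kₙ}Aₙ) → H(A₁,…,Aₙ))`
for finite filtrations). The source treats finiteness of the induced filtration as evident; the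
proofs below are the routine verification for the Lean encoding of `HodgeTensor`
(`tensorPowerFiltration`, pulled back along `piTensorBaseChange`).

## Proofs

* `piTensorBaseChange_bijective`: for a finite index type `ι` the comparison map
  `ℂ ⊗ (⨂_ι V) → ⨂_ι (ℂ ⊗ V)` is bijective — it carries the `ℂ`-basis `1 ⊗ (⊗ᵢ b_{fᵢ})`
  (`Algebra.TensorProduct.basis` of `Basis.piTensorProduct`) to the `ℂ`-basis `⊗ᵢ (1 ⊗ b_{fᵢ})`
  (`Basis.piTensorProduct` of `Algebra.TensorProduct.basis`), `b` a `ℚ`-basis of `V`, so it is the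
  linear equivalence `Basis.equiv` matching them.
* Separation (`exists_tensorPowerFiltration_eq_bot_holds`): if `F^q V = 0`, then for
  `p = r (q - 1) + 1` every multi-index `a : Fin r → ℤ` with `p ≤ Σ aᵢ` has some `aᵢ ≥ q`, so the
  factor `F^{aᵢ} V` vanishes and `⊗ᵢ F^{aᵢ} V → ⊗ᵢ V_ℂ` is zero (a pure tensor with a zero coordinate
  vanishes); the pull-back of `0` along the injective `piTensorBaseChange` is `0`. For `r = 0` the
  bound reads `1 ≤ 0`, so `F^1 = 0` (and `F^0 = ℚ(0)_ℂ`).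
* Exhaustion (`exists_tensorPowerFiltration_eq_top_holds`): if `F^t V = V_ℂ`, then for `p = r t`
  the constant multi-index `a ≡ t` contributes `⊗ᵢ F^t V → ⊗ᵢ V_ℂ`, which is onto (pure tensors
  span), and the pull-back of everything is everything; no surjectivity of `piTensorBaseChange` is
  needed.

## References

* [DeligneHodgeII1971] P. Deligne, *Théorie de Hodge II*, Publ. Math. IHÉS 40 (1971), 5–57, §1.1.12
  (not held locally: doi:10.1007/bf02684692 listed for acquisition; statement taken from the
  vendored fact and the secondary source below).
* [CattaniElZeinGriffithsLe2014] E. Cattani, F. El Zein, P. A. Griffiths, Lê D. T. (eds.),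
  *Hodge Theory*, Math. Notes 49, Princeton (2014), Ch. 3 (F. El Zein, Lê D. T.), §3.2.1.6–3.2.1.7,
  p. 154.
-/

open scoped TensorProduct PiTensorProduct

noncomputable section

namespace Literature.AlgebraicGeometry.Motives

namespace HodgeStructure

universe u w

variable {V : Type u} [AddCommGroup V] [Module ℚ V] {n : ℤ}

variable (V) in
/-- For a finite index type `ι`, the comparison map
`piTensorBaseChange V ι : ℂ ⊗ (⨂_ι V) →ₗ[ℂ] ⨂_ι (ℂ ⊗ V)` is bijective (base change commutes with
finite tensor products): it carries the `ℂ`-basis `1 ⊗ (⊗ᵢ b_{fᵢ})` of `ℂ ⊗ V^{⊗ι}` to the `ℂ`-basis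
`⊗ᵢ (1 ⊗ b_{fᵢ})` of `(ℂ ⊗ V)^{⊗ι}` (`b` a `ℚ`-basis of `V`; `Algebra.TensorProduct.basis`,
`Basis.piTensorProduct`), hence equals the linear equivalence `Basis.equiv` matching these bases.
[folklore] -/
theorem piTensorBaseChange_bijective (ι : Type w) [Finite ι] :
    Function.Bijective (piTensorBaseChange V ι) := by
  let b := Module.Free.chooseBasis ℚ V
  let b₁ : Module.Basis (ι → Module.Free.ChooseBasisIndex ℚ V) ℂ (ℂ ⊗[ℚ] (⨂[ℚ] _ : ι, V)) :=
    Algebra.TensorProduct.basis ℂ (Basis.piTensorProduct fun _ : ι => b)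
  let b₂ : Module.Basis (ι → Module.Free.ChooseBasisIndex ℚ V) ℂ (⨂[ℂ] _ : ι, (ℂ ⊗[ℚ] V)) :=
    Basis.piTensorProduct fun _ : ι => Algebra.TensorProduct.basis ℂ b
  have h : piTensorBaseChange V ι = (b₁.equiv b₂ (Equiv.refl _)).toLinearMap := by
    refine b₁.ext fun f => ?_
    rw [LinearEquiv.coe_coe, Module.Basis.equiv_apply, Equiv.refl_apply]
    simp [b₁, b₂, Algebra.TensorProduct.basis_apply, Basis.piTensorProduct_apply,
      piTensorBaseChange_tmul_tprod]
  rw [h]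
  exact (b₁.equiv b₂ (Equiv.refl _)).bijective

/-- **Separation of the tensor-power filtration**, discharging the named fact
`HodgeStructure.exists_tensorPowerFiltration_eq_bot`: for every pure `ℚ`-Hodge structure `H` on `V`
and every `r`, some `F^p (V^{⊗r})` is zero. Source: Deligne, *Théorie de Hodge II*, 1.1.12 (the
filtration `F^p = Σ_{Σ aᵢ ≥ p} ⊗ᵢ F^{aᵢ}` induced by finite filtrations on a tensor power), as
reproduced in Cattani–El Zein–Griffiths–Lê, *Hodge Theory*, §3.2.1.7. Proof: with `F^q V = 0`,
take `p = r (q - 1) + 1`; any multi-index with `Σ aᵢ ≥ p` has a coordinate `aᵢ ≥ q`, so that factor,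
hence the image of `⊗ᵢ F^{aᵢ} V`, vanishes, and its pull-back along the injective
`piTensorBaseChange` (`piTensorBaseChange_bijective`) is zero.
[cite: DeligneHodgeII1971, 1.1.12] -/
theorem exists_tensorPowerFiltration_eq_bot_holds :
    exists_tensorPowerFiltration_eq_bot (V := V) (n := n) := by
  intro H r
  obtain ⟨q, hq⟩ := H.exists_F_eq_bot
  refine ⟨r * (q - 1) + 1, eq_bot_iff.2 (iSup₂_le fun a ha => ?_)⟩
  obtain ⟨i, hi⟩ : ∃ i, q ≤ a i := by
    by_contra h
    have hle : ∑ i, a i ≤ ∑ _i : Fin r, (q - 1) :=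
      Finset.sum_le_sum fun i _ => Int.le_sub_one_of_lt (lt_of_not_ge fun hi => h ⟨i, hi⟩)
    rw [Finset.sum_const, Finset.card_univ, Fintype.card_fin, nsmul_eq_mul] at hle
    omega
  have hFi : H.F (a i) = ⊥ := eq_bot_iff.2 (hq ▸ H.antitone_F hi)
  have hrange : LinearMap.range (PiTensorProduct.mapIncl fun j => H.F (a j)) = ⊥ := by
    rw [LinearMap.range_eq_bot]
    ext x
    have hx : ((x i : H.F (a i)) : ℂ ⊗[ℚ] V) = 0 := by
      rw [← Submodule.mem_bot ℂ, ← hFi]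
      exact (x i).2
    simpa using MultilinearMap.map_coord_zero (PiTensorProduct.tprod ℂ)
      (m := fun j => ((x j : H.F (a j)) : ℂ ⊗[ℚ] V)) i hx
  rw [hrange, Submodule.comap_bot, le_bot_iff, LinearMap.ker_eq_bot]
  exact (piTensorBaseChange_bijective V (Fin r)).injective

/-- **Exhaustion of the tensor-power filtration**, discharging the named fact
`HodgeStructure.exists_tensorPowerFiltration_eq_top`: for every pure `ℚ`-Hodge structure `H` on `V`
and every `r`, some `F^p (V^{⊗r})` is everything. Source: Deligne, *Théorie de Hodge II*, 1.1.12,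
as reproduced in Cattani–El Zein–Griffiths–Lê, *Hodge Theory*, §3.2.1.7. Proof: with
`F^t V = V_ℂ`, take `p = r t` and the constant multi-index `a ≡ t`: the map `⊗ᵢ F^t V → ⊗ᵢ V_ℂ` is
onto (its range contains all pure tensors, which span), so already this summand, pulled back
along `piTensorBaseChange`, is everything. [cite: DeligneHodgeII1971, 1.1.12] -/
theorem exists_tensorPowerFiltration_eq_top_holds :
    exists_tensorPowerFiltration_eq_top (V := V) (n := n) := by
  intro H r
  obtain ⟨t, ht⟩ := H.exists_F_eq_top
  refine ⟨r * t, eq_top_iff.2 (le_trans ?_ (le_iSup₂_of_le (fun _ => t) (by simp) le_rfl))⟩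
  have hrange : LinearMap.range (PiTensorProduct.mapIncl fun _ : Fin r => H.F t) = ⊤ := by
    rw [PiTensorProduct.mapIncl, PiTensorProduct.map_range_eq_span_tprod, eq_top_iff,
      ← PiTensorProduct.span_tprod_eq_top, Submodule.span_le]
    rintro _ ⟨x, rfl⟩
    exact Submodule.subset_span ⟨fun i => ⟨x i, by simp [ht]⟩, rfl⟩
  rw [hrange, Submodule.comap_top]

end HodgeStructure

end Literature.AlgebraicGeometry.Motives

end
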